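import Summits.ResolutionOfSingularities.ResolutionOfSingularities.Theorems.FrobeniusClosingPatchingRelPerfectCrossingLinesTowerCharts
import HarnessLib

/-!
# Crux `PatchingRelPerfect` (stmt-ResolutionOfSingularities-16161), chain W5.2 — the CROSSING-LINES
# member `I = (x₀x₁ + x₂x₃, x₃²) + 𝔪⁴`, part 3b: the LINE STEP at the crossing (ring level)

[OURS · L1 W5.2 · kernel certificate, res-L1-w52-plan-1 NAMING 2026-08-27T17:00:47Z (O2′)]
Level 1 of the hand tower on the chart of `x₂` of `Bl_𝔪` (`u = x₂` the exceptional parameter,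
`a = x₀/x₂`, `b = x₁/x₂`, `p = x₃/x₂`, host `w = a b + p`, the strict transform of the quadric
`x₀x₁ + x₂x₃`).  The residual of the member is `K = (w) + (p²) + (u²)`, of order `1`, with
cosupport `V(u, p, a b)` = the two LINES `L₀ = V(u, a, w)` and `L₁ = V(u, b, w)` of `E`
crossing at the origin — the first member of the stratum with a member/host-TANGENCY pole
(`V(p)` is tangent to the host `V(w)` along the crossing).  The S-avatars arrive as

  `C = (a, p, u)` (`= 𝓘_{L₀}`), `D = (p, u)`, `J₁ = (w) + C²` (avatar of the surface `S₁`),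
  `A₁ = (w) + C·D` (avatar of `L₀ ∪ L₁`, then of `L₁′`, then of `L₁″`),
  `T₁ = (w)·C² + A₁²` (avatar of the surface `S₂`),

and THIS FILE proves (chart algebra in part 3a, `…CrossingLinesTowerCharts`), for every regular ring `A` and `u, a, b, p ∈ A` with `(u, w, a)`,
`(u, w, b)` weakly regular, `w` a non-zero-divisor and `A/(u, a, w)`, `A/(u, b, w)` regular:

* `CrossingLines.surfaceHyp_aChart` — PERSISTENCE of the hypotheses of the surface step
  (part 2) to the `a`-chart of `Bl_{L₀}`: `(w′, g)`, `(w′, u′, b)` weakly regular with regular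
  quotients (`g = a/1`, `u′ = u/a`, `w′ = w/a`; strict transforms of `V(u)` and of `V(u, w)`,
  `ChartStrictTransform` p512186 and part 1);
* `CrossingLines.crossingTower_isRegular` — **every blowing up of `Spec A` along
  `(K · J₁ · A₁ · T₁) · C` is a regular scheme**: `Bl_{L₀}`; on its `w`-chart everything is
  Cartier; on its `u`-chart the four factors are `g⁵ · N⁵`, `N = (w′, g)` the surface `S₁`
  (`isRegular_of_isBlowup_pair_pow`); on its `a`-chart they are `g⁵ · (K₁ A₂ B₂) · N` — the
  surface step of part 2 (`surfaceStep_isRegular`), which ends in the conic tower of the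
  two-quadric member along the strict transform `L₁″`.

Any regular ring, no dimension / characteristic hypothesis; fact-free; nothing here is a
statement of the manuscript under review (AI-written; AI review weaker than expert review).

## References

* Q. Liu, *Algebraic Geometry and Arithmetic Curves*, OUP 2002, Thm. 8.1.19 (a). [Liu2002]
* The Stacks Project, Tags 080A, 080B, 0804, 0BIQ. [StacksProject]
* U. Görtz, T. Wedhorn, *Algebraic Geometry I* (2nd ed., 2020), Prop. 13.96 (2). [GortzWedhorn2020]
* H. Matsumura, *Commutative Ring Theory*, CUP 1986, Thm. 16.2 (i). [Matsumura1987]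
-/

-- `Summit.<Summit>.<Sub>.Theorems` with `Sub = Summit` (single-conjunct summit, D-0017)
set_option linter.dupNamespace false

noncomputable section

open CategoryTheory CategoryTheory.Limits AlgebraicGeometry Literature.AlgebraicGeometry.Resolution
open scoped Pointwise nonZeroDivisors

namespace Summit.ResolutionOfSingularities.ResolutionOfSingularities.Theorems

universe u

namespace CrossingLines

open CuspMember TwoQuadric

/-! ## Persistence of the hypotheses to the `a`-chart of `Bl_C`, `C = (u, a, w)` -/

section Persistence

variable {A : Type u} [CommRing A] (u a b p : A)

/-- The centre `C = (u, a, w)`, `w = a b + p`, as a family. -/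
local notation3 "xx" => (![u, a, a * b + p] : Fin 3 → A)
/-- The complement `{a}` of `J = {w, u}`, indexed by `Fin 1`. -/
local notation3 "emb₁" => (fun _ : Fin 1 => (1 : Fin 3))
/-- `J = {w, u}` as a sub-family of the indices `≠ 1`. -/
local notation3 "jJ₁" =>
  (![⟨2, of_decide_eq_true rfl⟩, ⟨0, of_decide_eq_true rfl⟩] : Fin 2 → {j : Fin 3 // j ≠ emb₁ 0})
/-- The complement `{a, w}` of `J = {u}`. -/
local notation3 "emb₂" => (![(1 : Fin 3), 2] : Fin 2 → Fin 3)
/-- `J = {u}` as a sub-family of the indices `≠ 1`. -/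
local notation3 "jJ₂" => (fun _ : Fin 1 => (⟨0, of_decide_eq_true rfl⟩ : {j : Fin 3 // j ≠ emb₂ 0}))

/-- The base ideal of `jJ₁` is `(w, u)`. [folklore] -/
theorem Q₁_eq : Ideal.span (Set.range fun k : Fin 2 => xx (jJ₁ k).1) =
    Ideal.span {a * b + p} ⊔ Ideal.span {u} := by
  have : (fun k : Fin 2 => xx (jJ₁ k).1) = ![a * b + p, u] := by funext k; fin_cases k <;> rfl
  rw [this, span_range_vec2]

/-- The exceptional ideal of `jJ₁` is `(w′, u′)`. [folklore] -/
theorem E₁_eq : Ideal.span (Set.range fun k : Fin 2 => chartGen xx (emb₁ 0) (jJ₁ k).1) =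
    Ideal.span {chartGen xx 1 2} ⊔ Ideal.span {chartGen xx 1 0} := by
  have : (fun k : Fin 2 => chartGen xx (emb₁ 0) (jJ₁ k).1) = ![chartGen xx 1 2, chartGen xx 1 0] := by
    funext k; fin_cases k <;> rfl
  rw [this, span_range_vec2]

/-- The base ideal of `jJ₂` is `(u)`. [folklore] -/
theorem Q₂_eq : Ideal.span (Set.range fun k : Fin 1 => xx (jJ₂ k).1) = Ideal.span {u} := by
  have : (fun k : Fin 1 => xx (jJ₂ k).1) = fun _ => u := by funext k; rfl
  rw [this, Set.range_const]

/-- The exceptional ideal of `jJ₂` is `(u′)`. [folklore] -/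
theorem E₂_eq : Ideal.span (Set.range fun k : Fin 1 => chartGen xx (emb₂ 0) (jJ₂ k).1) =
    Ideal.span {chartGen xx 1 0} := by
  have : (fun k : Fin 1 => chartGen xx (emb₂ 0) (jJ₂ k).1) = fun _ => chartGen xx 1 0 := by
    funext k; rfl
  rw [this, Set.range_const]
  rfl

set_option maxHeartbeats 400000 in
/-- **PERSISTENCE to the `a`-chart.** For `(u, w, a)` and `(u, w, b)` weakly regular on `A`
(`w = a b + p`), `w` a non-zero-divisor and `A/(u, a, w)`, `A/(u, b, w)` regular, on the
`a`-chart `B` of `Bl_{(u, a, w)} Spec A` (`g = a/1`, `u′ = u/a`, `w′ = w/a`): `(w′, g)` and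
`(w′, u′, b)` are weakly regular, and `B/(w′, g)`, `B/(w′, u′, b)` are regular rings.
[cite: GortzWedhorn2020, Prop. 13.96 (2)] [cite: StacksProject, Tag 0BIQ] [cite: Matsumura1987, Thm. 16.2 (i)] -/
theorem surfaceHyp_aChart (hwa : RingTheory.Sequence.IsWeaklyRegular A [u, a * b + p, a])
    (hwb : RingTheory.Sequence.IsWeaklyRegular A [u, a * b + p, b]) (hw0 : a * b + p ∈ A⁰)
    (hrega : IsRegularRing (A ⧸ (Ideal.span {u} ⊔ Ideal.span {a} ⊔ Ideal.span {a * b + p})))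
    (hregb : IsRegularRing (A ⧸ (Ideal.span {u} ⊔ Ideal.span {b} ⊔ Ideal.span {a * b + p}))) :
    RingTheory.Sequence.IsWeaklyRegular (chartRing xx 1) [chartGen xx 1 2, chartBase xx 1 a] ∧
    IsRegularRing (chartRing xx 1 ⧸ (Ideal.span {chartGen xx 1 2} ⊔ Ideal.span {chartBase xx 1 a})) ∧
    RingTheory.Sequence.IsWeaklyRegular (chartRing xx 1)
      [chartGen xx 1 2, chartGen xx 1 0, chartBase xx 1 b] ∧
    IsRegularRing (chartRing xx 1 ⧸ (Ideal.span {chartGen xx 1 2} ⊔ Ideal.span {chartGen xx 1 0} ⊔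
      Ideal.span {chartBase xx 1 b})) := by
  -- the centre is quasi-regular with regular quotient
  have hx : IsQuasiRegular xx := by
    have h := ChartPrincipal.isQuasiRegular_comp_equiv (Equiv.swap (1 : Fin 3) 2) (isQuasiRegular_vec3 hwa)
    rwa [vec3_swap12] at h
  haveI hAx : IsRegularRing (A ⧸ Ideal.span (Set.range xx)) := by rw [span_range_vec3]; exact hrega
  have hjJ₁ : Function.Injective jJ₁ := by decide
  have hjJ₂ : Function.Injective jJ₂ := fun i j _ => Subsingleton.elim i j
  have cov₁ : ∀ j : Fin 3, (∃ k, emb₁ k = j) ∨ ∃ k, (jJ₁ k).1 = j := by decide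
  have cov₂ : ∀ j : Fin 3, (∃ k, emb₂ k = j) ∨ ∃ k, (jJ₂ k).1 = j := by decide
  have hu0 : u ∈ A⁰ := nzd_of_isWeaklyRegular₁ hwa
  have hg : chartBase xx 1 a ∈ (chartRing xx 1)⁰ :=
    reesChartBase_mem_nonZeroDivisors (xx 1) (Ideal.mem_span_range_self (f := xx) (x := 1))
  have hw' : chartGen xx 1 2 ∈ (chartRing xx 1)⁰ := chartGen_mem_nonZeroDivisors xx 1 2 hw0
  have hu' : chartGen xx 1 0 ∈ (chartRing xx 1)⁰ := chartGen_mem_nonZeroDivisors xx 1 0 hu0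
  -- (i) `(w′, g)` weakly regular: swap the chart family `(g, w′)`
  obtain ⟨-, hregp⟩ := pair_hyp u a (a * b + p) hx 1 ⟨2, by decide⟩
  have hfam : RingTheory.Sequence.IsWeaklyRegular (chartRing xx 1)
      (List.ofFn (Fin.cons (chartBase xx 1 a) fun _ : Fin 1 => chartGen xx 1 2)) :=
    CoreRungTower.isWeaklyRegular_chartFamily xx 1 (fun _ : Fin 1 => (⟨2, by decide⟩ : {j : Fin 3 // j ≠ 1}))
      hx (fun i j _ => Subsingleton.elim i j)
  have hi : RingTheory.Sequence.IsWeaklyRegular (chartRing xx 1) [chartGen xx 1 2, chartBase xx 1 a] :=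
    isWeaklyRegular_two hw' ((ConeRung.isSMulRegular_quot_span_iff _ _).mp
      (ConeRung.isSMulRegular_quot_span_swap _ _ hg ((ConeRung.isWeaklyRegular_pair_iff _ _).mp hfam).2))
  -- (ii) `B/(w′, g)` regular
  have hii : IsRegularRing (chartRing xx 1 ⧸ (Ideal.span {chartGen xx 1 2} ⊔ Ideal.span {chartBase xx 1 a})) := by
    have h : IsRegularRing (chartRing xx 1 ⧸ Ideal.span (Set.range ![chartBase xx 1 a, chartGen xx 1 2])) := hregp
    rw [span_range_vec2, sup_comm] at h
    exact h
  -- (iii a) `w′` is regular modulo `u′` (strict transform of `V(u)`), hence `u′` modulo `w′` (swap)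
  have hwu : ∀ z, chartGen xx 1 2 * z ∈ Ideal.span {chartGen xx 1 0} → z ∈ Ideal.span {chartGen xx 1 0} := by
    obtain ⟨Θ, hΘ, -, hΘemb⟩ := ChartStrictTransform.exists_strictTransformHom xx emb₂ 0 jJ₂ hx hjJ₂ cov₂
    have hwb : Ideal.Quotient.mk (Ideal.span (Set.range fun k : Fin 1 => xx (jJ₂ k).1)) (xx (emb₂ 1)) ∈
        (A ⧸ Ideal.span (Set.range fun k : Fin 1 => xx (jJ₂ k).1))⁰ := by
      refine mk_mem_nonZeroDivisors_of_forall fun z hz => ?_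
      rw [Q₂_eq] at hz ⊢
      exact forall_mem_of_isWeaklyRegular₂ hwa z hz
    have h1 : Ideal.Quotient.mk (Ideal.span (Set.range fun k : Fin 1 => chartGen xx (emb₂ 0) (jJ₂ k).1))
        (chartGen xx (emb₂ 0) (emb₂ 1)) ∈
        (chartRing xx (emb₂ 0) ⧸ Ideal.span (Set.range fun k : Fin 1 => chartGen xx (emb₂ 0) (jJ₂ k).1))⁰ := by
      refine mem_nonZeroDivisors_of_injective (f := Θ) hΘ.1 ?_
      rw [hΘemb]
      exact chartGen_mem_nonZeroDivisors _ 0 1 hwb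
    rw [E₂_eq] at h1
    have h4 : Ideal.Quotient.mk (Ideal.span {chartGen xx 1 0}) (chartGen xx 1 2) ∈
        (chartRing xx 1 ⧸ Ideal.span {chartGen xx 1 0})⁰ := h1
    exact forall_mem_of_mk_mem_nonZeroDivisors h4
  have huw : ∀ z, chartGen xx 1 0 * z ∈ Ideal.span {chartGen xx 1 2} → z ∈ Ideal.span {chartGen xx 1 2} :=
    (ConeRung.isSMulRegular_quot_span_iff _ _).mp (ConeRung.isSMulRegular_quot_span_swap _ _ hu'
      ((ConeRung.isSMulRegular_quot_span_iff _ _).mpr hwu))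
  -- (iii b) `b/1` is regular modulo `(w′, u′)` (strict transform of `V(w, u)`)
  have hnzb : Ideal.Quotient.mk (Ideal.span (Set.range fun k : Fin 2 => xx (jJ₁ k).1)) b ∈
      (A ⧸ Ideal.span (Set.range fun k : Fin 2 => xx (jJ₁ k).1))⁰ := by
    refine mk_mem_nonZeroDivisors_of_forall fun z hz => ?_
    rw [Q₁_eq, sup_comm] at hz ⊢
    exact forall_mem_of_isWeaklyRegular₃ hwb z hz
  have hb' : ∀ z, chartBase xx 1 b * z ∈ Ideal.span {chartGen xx 1 2} ⊔ Ideal.span {chartGen xx 1 0} →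
      z ∈ Ideal.span {chartGen xx 1 2} ⊔ Ideal.span {chartGen xx 1 0} := by
    have h := ChartStrictTransform.mk_chartBase_mem_nonZeroDivisors xx emb₁ 0 jJ₁ hx hjJ₁ cov₁ hnzb
    rw [E₁_eq] at h
    exact forall_mem_of_mk_mem_nonZeroDivisors h
  have hiii : RingTheory.Sequence.IsWeaklyRegular (chartRing xx 1)
      [chartGen xx 1 2, chartGen xx 1 0, chartBase xx 1 b] := isWeaklyRegular_three hw' huw hb'
  -- (iv) `B/(w′, u′, b)` regular: `B/(w′, u′) ≅ A/(w, u)` (part 1), `ā` regular modulo `(w, u)`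
  have hnza : Ideal.Quotient.mk (Ideal.span (Set.range fun k : Fin 2 => xx (jJ₁ k).1)) (xx (emb₁ 0)) ∈
      (A ⧸ Ideal.span (Set.range fun k : Fin 2 => xx (jJ₁ k).1))⁰ := by
    refine mk_mem_nonZeroDivisors_of_forall fun z hz => ?_
    rw [Q₁_eq, sup_comm] at hz ⊢
    exact forall_mem_of_isWeaklyRegular₃ hwa z hz
  have hiv : IsRegularRing (chartRing xx 1 ⧸ (Ideal.span {chartGen xx 1 2} ⊔ Ideal.span {chartGen xx 1 0} ⊔
      Ideal.span {chartBase xx 1 b})) := by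
    have hreg' : IsRegularRing (A ⧸ (Ideal.span (Set.range fun k : Fin 2 => xx (jJ₁ k).1) ⊔ Ideal.span {b})) := by
      have e : Ideal.span {a * b + p} ⊔ Ideal.span {u} ⊔ Ideal.span {b} =
          Ideal.span {u} ⊔ Ideal.span {b} ⊔ Ideal.span {a * b + p} := by ac_rfl
      rw [Q₁_eq, e]
      exact hregb
    have h := isRegularRing_quot_sup_map_single xx emb₁ jJ₁ hx hjJ₁ cov₁ hnza (Ideal.span {b}) hreg'
    rw [E₁_eq, map_span_singleton] at h
    exact h
  exact ⟨hi, hii, hiii, hiv⟩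

end Persistence

/-! ## The crossing tower over `Bl_C`, `C = (u, a, w)` -/

section Tower

variable {A : Type u} [CommRing A] [IsRegularRing A] (u a b p : A)

/-- The centre `C = (u, a, w)`, `w = a b + p`, as a family. -/
local notation3 "xx" => (![u, a, a * b + p] : Fin 3 → A)
/-- The host `w = a b + p`. -/
local notation3 "ww" => (a * b + p)
/-- The residual of the member: `K = (w) + (p²) + (u²)`. -/
local notation3 "KK" => (Ideal.span {ww} ⊔ Ideal.span {p ^ 2} ⊔ Ideal.span {u ^ 2})
/-- The centre `C = (a) + (p) + (u)`. -/
local notation3 "CC" => (Ideal.span {a} ⊔ Ideal.span {p} ⊔ Ideal.span {u})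
/-- `D = (p) + (u)` (the chart image of `(x₃) + 𝔪²`). -/
local notation3 "DD" => (Ideal.span {p} ⊔ Ideal.span {u})

set_option maxHeartbeats 800000 in
-- `pow_mem` vs the statement-level `g ^ 5`: instance-path defeq through `HomogeneousLocalization` (as in p508825)
/-- **THE CROSSING TOWER (ring level).** For every regular ring `A` and `u, a, b, p ∈ A` with
`(u, w, a)` and `(u, w, b)` weakly regular (`w = a b + p`), `w` a non-zero-divisor and `A/(u, a, w)`,
`A/(u, b, w)` regular rings, every blowing up of `Spec A` along `(K · J₁ · A₁ · T₁) · C`,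
`C = (a, p, u)`, `K = (w) + (p²) + (u²)`, `J₁ = (w) + C²`, `A₁ = (w) + C·((p) + (u))`,
`T₁ = (w)·C² + A₁²`, is a regular scheme: `Bl_C` (the line `L₀`, a regular centre), then chart by
chart: Cartier (`w`-chart), `g⁵ · N⁵` with `N = (w′, g)` the surface `S₁` (`u`-chart,
`isRegular_of_isBlowup_pair_pow`), and `g⁵ · (K₁ A₂ B₂) · N` (`a`-chart, the surface step
`surfaceStep_isRegular` of part 2, ending in the two-quadric conic tower along `L₁″`).
[cite: Liu2002, Thm. 8.1.19 (a)] [cite: StacksProject, Tag 080A] [cite: StacksProject, Tag 0BIQ] -/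
theorem crossingTower_isRegular (hwa : RingTheory.Sequence.IsWeaklyRegular A [u, a * b + p, a])
    (hwb : RingTheory.Sequence.IsWeaklyRegular A [u, a * b + p, b]) (hw0 : a * b + p ∈ A⁰)
    (hrega : IsRegularRing (A ⧸ (Ideal.span {u} ⊔ Ideal.span {a} ⊔ Ideal.span {a * b + p})))
    (hregb : IsRegularRing (A ⧸ (Ideal.span {u} ⊔ Ideal.span {b} ⊔ Ideal.span {a * b + p})))
    {Y : Scheme.{u}} {f : Y ⟶ Spec (.of A)}
    (hf : IsBlowup f (affineBlowup.idealSheaf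
      ((KK * (Ideal.span {ww} ⊔ CC ^ 2) * (Ideal.span {ww} ⊔ CC * DD) *
        (Ideal.span {ww} * CC ^ 2 ⊔ (Ideal.span {ww} ⊔ CC * DD) ^ 2)) * CC))) :
    Scheme.IsRegular Y := by
  rw [centre_eq u a b p] at hf
  have hx : IsQuasiRegular xx := by
    have h := ChartPrincipal.isQuasiRegular_comp_equiv (Equiv.swap (1 : Fin 3) 2) (isQuasiRegular_vec3 hwa)
    rwa [vec3_swap12] at h
  haveI hAx : IsRegularRing (A ⧸ Ideal.span (Set.range xx)) := by rw [span_range_vec3]; exact hrega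
  refine isRegular_of_isBlowup_mul_of_charts xx _ (fun j Y' ρ hρ => ?_) hf
  haveI hB : IsRegularRing (chartRing xx j) := isRegularRing_blowupChart xx j hx
  have cM : (Ideal.span (Set.range xx)).map (chartBase xx j) = Ideal.span {chartBase xx j (xx j)} :=
    map_reesChartBase_eq (xx j) (Ideal.mem_span_range_self (f := xx) (x := j))
  have cp₀ : chartBase xx j p = chartBase xx j (a * b + p) - chartBase xx j a * chartBase xx j b := by
    rw [map_add, map_mul]; ring
  have hj : j = 0 ∨ j = 1 ∨ j = 2 := by
    fin_cases j
    · exact Or.inl rfl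
    · exact Or.inr (Or.inl rfl)
    · exact Or.inr (Or.inr rfl)
  rcases hj with rfl | rfl | rfl
  · -- `u`-chart: `u = g`, `a = g a′`, `w = g w′`: the factors are `g⁵ · N⁵`, `N = (w′, g)`
    have hg : chartBase xx 0 u ∈ (chartRing xx 0)⁰ :=
      reesChartBase_mem_nonZeroDivisors (xx 0) (Ideal.mem_span_range_self (f := xx) (x := 0))
    have cM' : (Ideal.span (Set.range xx)).map (chartBase xx 0) = Ideal.span {chartBase xx 0 u} := cM
    have ca : chartBase xx 0 a = chartBase xx 0 u * chartGen xx 0 1 := reesChartBase_apply_eq_mul_chartGen xx 0 1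
    have cw : chartBase xx 0 (a * b + p) = chartBase xx 0 u * chartGen xx 0 2 :=
      reesChartBase_apply_eq_mul_chartGen xx 0 2
    have cp : chartBase xx 0 p = chartBase xx 0 u * (chartGen xx 0 2 - chartGen xx 0 1 * chartBase xx 0 b) := by
      rw [cp₀, cw, ca]; ring
    rw [Ideal.map_mul, Ideal.map_mul, Ideal.map_mul, map_K, map_J (hM := cM'), map_A (hM := cM'),
      map_T (hM := cM'), cw, cp, uChart_K (A := chartRing xx 0), aChart_J (A := chartRing xx 0),
      uChart_A (A := chartRing xx 0), aChart_T (A := chartRing xx 0), absorb_N (A := chartRing xx 0),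
      collect_uChart (A := chartRing xx 0)] at hρ
    obtain ⟨hq2, hreg2⟩ := pair_hyp u a (a * b + p) hx 0 ⟨2, by decide⟩
    refine CoreRungTower.isRegular_of_isBlowup_span_singleton_mul (pow_mem hg 5) _ (fun Y'' ρ' hρ' => ?_) hρ
    rw [sup_comm] at hρ'
    exact isRegular_of_isBlowup_pair_pow _ _ 4 hq2 hreg2 hρ'
  · -- `a`-chart: `a = g`, `u = g u′`, `w = g w′`, `p = g (w′ - b)`: the surface step of part 2
    have hg : chartBase xx 1 a ∈ (chartRing xx 1)⁰ :=
      reesChartBase_mem_nonZeroDivisors (xx 1) (Ideal.mem_span_range_self (f := xx) (x := 1))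
    have cM' : (Ideal.span (Set.range xx)).map (chartBase xx 1) = Ideal.span {chartBase xx 1 a} := cM
    have cu : chartBase xx 1 u = chartBase xx 1 a * chartGen xx 1 0 := reesChartBase_apply_eq_mul_chartGen xx 1 0
    have cw : chartBase xx 1 (a * b + p) = chartBase xx 1 a * chartGen xx 1 2 :=
      reesChartBase_apply_eq_mul_chartGen xx 1 2
    have cp : chartBase xx 1 p = chartBase xx 1 a * (chartGen xx 1 2 - chartBase xx 1 b) := by
      rw [cp₀, cw]; ring
    rw [Ideal.map_mul, Ideal.map_mul, Ideal.map_mul, map_K, map_J (hM := cM'), map_A (hM := cM'),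
      map_T (hM := cM'), cw, cu, cp, aChart_K (A := chartRing xx 1), aChart_J (A := chartRing xx 1),
      aChart_A (A := chartRing xx 1), aChart_T (A := chartRing xx 1), B₂_flat (A := chartRing xx 1),
      collect_aChart (A := chartRing xx 1)] at hρ
    obtain ⟨hi, hii, hiii, hiv⟩ := surfaceHyp_aChart u a b p hwa hwb hw0 hrega hregb
    refine CoreRungTower.isRegular_of_isBlowup_span_singleton_mul (pow_mem hg 5) _ (fun Y'' ρ' hρ' => ?_) hρ
    exact surfaceStep_isRegular _ _ _ _ hi hii hiii hiv hρ'
  · -- `w`-chart: `w = g`: everything is Cartier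
    have hg : chartBase xx 2 (a * b + p) ∈ (chartRing xx 2)⁰ :=
      reesChartBase_mem_nonZeroDivisors (xx 2) (Ideal.mem_span_range_self (f := xx) (x := 2))
    have cM' : (Ideal.span (Set.range xx)).map (chartBase xx 2) = Ideal.span {chartBase xx 2 (a * b + p)} := cM
    have cu : chartBase xx 2 u = chartBase xx 2 (a * b + p) * chartGen xx 2 0 :=
      reesChartBase_apply_eq_mul_chartGen xx 2 0
    have ca : chartBase xx 2 a = chartBase xx 2 (a * b + p) * chartGen xx 2 1 :=
      reesChartBase_apply_eq_mul_chartGen xx 2 1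
    have cp : chartBase xx 2 p = chartBase xx 2 (a * b + p) * (1 - chartGen xx 2 1 * chartBase xx 2 b) := by
      rw [cp₀, ca]; ring
    rw [Ideal.map_mul, Ideal.map_mul, Ideal.map_mul, map_K, map_J (hM := cM'), map_A (hM := cM'),
      map_T (hM := cM'), cu, cp,
      span_sup_sup_eq (A := chartRing xx 2)
        ⟨chartBase xx 2 (a * b + p) * (1 - chartGen xx 2 1 * chartBase xx 2 b) ^ 2, by ring⟩
        ⟨chartBase xx 2 (a * b + p) * chartGen xx 2 0 ^ 2, by ring⟩,
      wChart_J (A := chartRing xx 2), wChart_A (A := chartRing xx 2), wChart_T (A := chartRing xx 2),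
      Ideal.span_singleton_mul_span_singleton, Ideal.span_singleton_mul_span_singleton,
      Ideal.span_singleton_mul_span_singleton] at hρ
    exact isRegular_of_isBlowup_span_singleton_nzd (mul_mem (mul_mem (mul_mem hg hg) hg) (pow_mem hg 2)) hρ

end Tower

end CrossingLines

end Summit.ResolutionOfSingularities.ResolutionOfSingularities.Theorems

end
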